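import Literature.NumberTheory.DiophantineGeometry.BelyiLemmaProofs
import Literature.NumberTheory.DiophantineGeometry.BelyiPolynomialHeightProofs
import Literature.NumberTheory.DiophantineGeometry.BelyiDegree
import HarnessLib

/-!
# Belyi witnesses exist for every algebraic `t`: `deg_B(ℙ¹; 0, 1, ∞, t) ≥ 1`

Topic `NumberTheory/DiophantineGeometry`; companion of `BelyiDegree.lean` (the witness predicate
`HasBelyiWitness d t` and `belyiDegree t` of the four-pointed line `(ℙ¹; 0, 1, ∞, t)`, used by the
routes `Summit.ABC.ABC.Theses.BelyiDegreeSmooth` / `…BelyiSqueeze`), which records as "not proved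
here": *"by Belyi's theorem a witness exists for every algebraic `t`"*. This file proves it, from
the tree's proof of Belyi's lemma over `ℚ` (`BelyiLemmaProofs`:
`BelyiAlgorithm.exists_belyi_polynomial`, [Bombieri–Gubler, Lemma 12.2.7]) and the tree's
Riemann–Hurwitz / Mason–Stothers equality count for polynomial pairs
(`BelyiPolynomialHeightProofs`: `card_roots_add_card_roots_eq`):

* `hasBelyiWitness_of_polynomial` — a polynomial `p ∈ ℂ[x]` of degree `d ≥ 1` with finite critical
  values in `{0, 1}` and `p(0), p(1), p(t) ∈ {0, 1}` is a witness of `HasBelyiWitness d t` (with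
  `q = 1`: `∞ ↦ ∞`, and `p · (p - 1)` has exactly `d + 1` distinct roots);
* `exists_hasBelyiWitness_of_isAlgebraic` — **for every algebraic `t ∈ ℂ`,
  `∃ d, HasBelyiWitness d t`** (Belyi's lemma for the finite set `{0, 1, t}`);
* `belyiDegree_pos_of_isAlgebraic` — hence `0 < belyiDegree t`;
* `belyiDegree_le_natDegree_of_polynomial` — and `belyiDegree t ≤ deg h` for every such polynomial.

Theorems only; no definition, no named fact.

## References

* G. V. Belyĭ, Math. USSR Izv. 14 (1980) 247–256, Thm. 4 and §§1–3. [Belyi1980]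
* E. Bombieri, W. Gubler, *Heights in Diophantine Geometry*, CUP (2006), Lemma 12.2.7.
  [BombieriGubler2006]
-/

noncomputable section

namespace Literature.NumberTheory.DiophantineGeometry

open Polynomial

/-- **A polynomial Belyi map gives a Belyi witness.** If `p ∈ ℂ[x]` has degree `d ≥ 1`, all its
finite critical values in `{0, 1}` (`p'(z) = 0 ⇒ p(z) ∈ {0,1}`) and `p(0), p(1), p(t) ∈ {0, 1}`,
then
`β = p/1` is a witness of `HasBelyiWitness d t`: `∞ ↦ ∞` (the degree of `q = 1` drops), and
`p · 1 · (p - 1)` has exactly `d + 1` distinct roots — the Riemann–Hurwitz / Mason–Stothers equality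
count `#Z(p) + #Z(p - 1) = deg p + 1` of the tree's `card_roots_add_card_roots_eq`
(`BelyiPolynomialHeightProofs`). [folklore] -/
theorem hasBelyiWitness_of_polynomial {p : ℂ[X]} (hd : 0 < p.natDegree)
    (hcrit : ∀ z : ℂ, (derivative p).eval z = 0 → p.eval z = 0 ∨ p.eval z = 1) {t : ℂ}
    (h0 : p.eval 0 = 0 ∨ p.eval 0 = 1) (h1 : p.eval 1 = 0 ∨ p.eval 1 = 1)
    (ht : p.eval t = 0 ∨ p.eval t = 1) : HasBelyiWitness p.natDegree t := by
  classical
  have hp : p ≠ 0 := ne_zero_of_natDegree_gt hd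
  have hp1 : p - 1 ≠ 0 := by
    intro h
    have := congr_arg natDegree h
    rw [show (p - 1 : ℂ[X]) = p - C 1 by rw [map_one], natDegree_sub_C, natDegree_zero] at this
    omega
  have hprod : p * 1 * (p - 1) ≠ 0 := by
    rw [mul_one]; exact mul_ne_zero hp hp1
  -- the value condition `p(s) ∈ {0,1}` is `(p · 1 · (p - 1))(s) = 0`
  have heval : ∀ s : ℂ, (p.eval s = 0 ∨ p.eval s = 1) → (p * 1 * (p - 1)).eval s = 0 := by
    intro s hs
    rw [eval_mul, eval_mul, eval_one, eval_sub, eval_one]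
    rcases hs with hs | hs
    · rw [hs]; ring
    · rw [hs]; ring
  refine ⟨p, 1, isCoprime_one_right, by rw [natDegree_one, Nat.max_eq_left (Nat.zero_le _)],
    Or.inr (Or.inl (by rw [natDegree_one]; exact hd)), ?_, heval 0 h0, heval 1 h1, heval t ht⟩
  -- the root count
  have hcount := card_roots_add_card_roots_eq (F := p) (G := p - 1) (δ := (1 : ℂ)) one_ne_zero
    (by rw [map_one]; ring) hd (IsAlgClosed.splits p) (IsAlgClosed.splits (p - 1))
    (IsAlgClosed.splits (derivative p)) (fun m hm _ ↦ by exact_mod_cast hm.ne')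
    (fun z hz ↦ by
      rcases hcrit z hz with h | h
      · exact Or.inl h
      · right
        rw [IsRoot.def, eval_sub, eval_one, h, sub_self])
  -- distinct roots of `p (p - 1)` = distinct roots of `p` ⊔ distinct roots of `p - 1`
  have hdisj : Disjoint p.roots.toFinset (p - 1).roots.toFinset := by
    rw [Finset.disjoint_left]
    intro z hz hz'
    rw [Multiset.mem_toFinset, mem_roots hp, IsRoot.def] at hz
    rw [Multiset.mem_toFinset, mem_roots hp1, IsRoot.def, eval_sub, eval_one, hz] at hz'
    norm_num at hz'
  rw [roots_mul hprod, mul_one, Multiset.toFinset_add, Finset.card_union_of_disjoint hdisj, hcount]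

/-- **Belyi's theorem for four-pointed lines**: for every algebraic number `t ∈ ℂ` the four-pointed
line `(ℙ¹; 0, 1, ∞, t)` has a Belyi witness — there is a Belyi map `β : ℙ¹ → ℙ¹` with
`0, 1, ∞, t` among its special points — so that `belyiDegree t` is a genuine minimum
("by Belyi's theorem a witness exists for every algebraic `t`", `BelyiDegree.lean`). The witness is
the polynomial `h ∈ ℚ[x]` of Belyi's lemma over `ℚ` (`BelyiAlgorithm.exists_belyi_polynomial`, the
tree's proof of [Bombieri–Gubler, Lemma 12.2.7]) for the finite set `{0, 1, t}`.
[cite: BombieriGubler2006, Lemma 12.2.7] -/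
theorem exists_hasBelyiWitness_of_isAlgebraic {t : ℂ} (ht : IsAlgebraic ℚ t) :
    ∃ d, HasBelyiWitness d t := by
  classical
  obtain ⟨h, hdeg, hcrit, hS⟩ := BelyiAlgorithm.exists_belyi_polynomial ({0, 1, t} : Finset ℂ)
    (fun s hs ↦ by
      simp only [Finset.mem_insert, Finset.mem_singleton] at hs
      rcases hs with rfl | rfl | rfl
      · exact isAlgebraic_zero
      · exact isAlgebraic_one
      · exact ht)
  set p : ℂ[X] := h.map (algebraMap ℚ ℂ) with hp
  have hpeval : ∀ z : ℂ, p.eval z = aeval z h := fun z ↦ by rw [hp, eval_map_algebraMap]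
  have hpderiv : ∀ z : ℂ, (derivative p).eval z = aeval z (derivative h) := fun z ↦ by
    rw [hp, Polynomial.derivative_map, eval_map_algebraMap]
  have hpdeg : p.natDegree = h.natDegree := by rw [hp, natDegree_map]
  refine ⟨p.natDegree, hasBelyiWitness_of_polynomial (by rw [hpdeg]; exact hdeg)
    (fun z hz ↦ ?_) ?_ ?_ ?_⟩
  · rw [hpeval]; rw [hpderiv] at hz; exact hcrit z hz
  · rw [hpeval]; exact hS 0 (by simp)
  · rw [hpeval]; exact hS 1 (by simp)
  · rw [hpeval]; exact hS t (by simp)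

/-- Hence **`deg_B(ℙ¹; 0, 1, ∞, t) ≥ 1`** for every algebraic `t` (the Belyi degree of
`BelyiDegree.lean` is not the junk value `0`). [cite: BombieriGubler2006, Lemma 12.2.7] -/
theorem belyiDegree_pos_of_isAlgebraic {t : ℂ} (ht : IsAlgebraic ℚ t) : 0 < belyiDegree t :=
  belyiDegree_pos (exists_hasBelyiWitness_of_isAlgebraic ht)

/-- And `deg_B(t) ≤ deg h` for the polynomial `h` of Belyi's lemma; in particular the Belyi degree
of an algebraic `t` is at most the degree of ANY non-constant `h ∈ ℚ[x]` with `h({0,1,t}) ⊆ {0,1}`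
and finite critical values in `{0,1}`. [folklore] -/
theorem belyiDegree_le_natDegree_of_polynomial {h : ℚ[X]} (hdeg : 0 < h.natDegree)
    (hcrit : ∀ z : ℂ, aeval z (derivative h) = 0 → aeval z h = 0 ∨ aeval z h = 1) {t : ℂ}
    (h0 : aeval (0 : ℂ) h = 0 ∨ aeval (0 : ℂ) h = 1)
    (h1 : aeval (1 : ℂ) h = 0 ∨ aeval (1 : ℂ) h = 1)
    (ht : aeval t h = 0 ∨ aeval t h = 1) : belyiDegree t ≤ h.natDegree := by
  set p : ℂ[X] := h.map (algebraMap ℚ ℂ) with hp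
  have hpeval : ∀ z : ℂ, p.eval z = aeval z h := fun z ↦ by rw [hp, eval_map_algebraMap]
  have hpderiv : ∀ z : ℂ, (derivative p).eval z = aeval z (derivative h) := fun z ↦ by
    rw [hp, Polynomial.derivative_map, eval_map_algebraMap]
  have hpdeg : p.natDegree = h.natDegree := by rw [hp, natDegree_map]
  rw [← hpdeg]
  refine belyiDegree_le (hasBelyiWitness_of_polynomial (by rw [hpdeg]; exact hdeg)
    (fun z hz ↦ ?_) ?_ ?_ ?_)
  · rw [hpeval]; rw [hpderiv] at hz; exact hcrit z hz
  · rw [hpeval]; exact h0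
  · rw [hpeval]; exact h1
  · rw [hpeval]; exact ht

end Literature.NumberTheory.DiophantineGeometry

end
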